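import Literature.IUT.HodgeArakelov.BadPrimeGaussianMonoidsGenuineRecordOrbitOfThetaKummer

/-!
# [IUTchII] Cor 3.5 (ii) at `∞Ψ^ι_env(M^Θ_*)` (faithful torsion form) AT THE GENUINE `θ_env` DATA — CLOSING DECL OF RECORD for the
# `∞`-clause of row «COR35ii-HORB-GENUINE» (file 11, proof-only): print's root condition and every [IUTchII]-internal input derived

S. Mochizuki, *Inter-universal Teichmüller theory II*, kurims Dec-2020 manuscript, Cor 3.5 (ii) p. 95 (`∞Ψ^ι_env(M^Θ_*) ⥲ ∞Ψ_ξ(M^Θ_*)`),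
Rmk 3.6.1 p. 101, Prop 1.4 p. 27, Prop 2.2 (ii) p. 66 [cite: Mochizuki2012, Cor 3.5 (ii) p.95]; [EtTh] Prop 1.4 (i)–(iii) pp. 20–22, Thm 1.6
(ii) p. 24, Def 2.5 (i) p. 39, Cor 2.19 (ii) p. 64 (refereed). Claim key `Mochizuki2012` DISPUTED (D-0012). PROOF-ONLY companion (abc-iut
cell, layer L6, seat abc-iut-w4-d004 gen 4; node **IUTchII:Cor3.5(ii)**, `∞`-level clause; companion of file 10's (I)-clause closing decl).
NO definition, NO `Prop` fact, NO instance. ONE theorem **`EtaleLevels.pi_restriction_inftyThetaMonoid_upToTorsion_toRecord_of_thetaKummer`**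
= abc-iut-w4-d004 gen 3's `pi_restriction_inftyThetaMonoid_upToTorsion_toRecord_of_mem_thetaEnv` (p434744) with print's root condition
`hroots` supplied by file 9's `horb_and_hroots_toRecord_inversion_of_thetaKummer` (second conjunct). Hypotheses = the `∞`-clause
residual BY NAME: the [EtTh] setting data + `IsEtThOrigin` + a `CyclotomeTower`, the [EtTh] inversion datum, the FUNCTION-level [EtTh]
Prop 1.4 package, `iota i₀ =` the limit action of `ι`, the evaluation sections with their augmentation datum (`q`/`w`/`hsec`), the model
data (`c` bijective, `μ ⊆ O`, `O` `Π`-stable), `θ ∈ θ^{i₀}_env(𝕄_*)`. HONEST FRAMING: composition of landed theorems; nothing disputed is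
asserted; no side is taken on [IUTchIII] Cor 3.12; typed ≠ proved ≠ endorsed.
-/

noncomputable section

namespace Literature.IUT.HodgeArakelov

namespace EtaleLevels

open Literature.AnabelianGeometry.EtaleTheta (ContH1 ThetaSetting RootSystem cyclotome)
open Literature.AnabelianGeometry.EtaleTheta CohomologySystemOfContH1 EtaleThetaDataOfSetting TemperedThetaMonoids
  BadPrimeGaussianMonoids

variable {p : ℕ} [Fact p.Prime] {D : Literature.AnabelianGeometry.EtaleTheta.ThetaSetting p}
  {E : D.EtaleThetaData} {l : ℕ} (C : E.DoubleUnderline l) (hC : D.Compat) (hS : D.Sec2Hyps)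
  (hl : l.Prime) (hp2 : p ≠ 2) (hpl : p ≠ l) (hζ : ∃ ζ : D.K, IsPrimitiveRoot ζ (4 * l))
  (mods : ∀ M : ℕ+, D.CyclotomeMod l M)
  (f : contCocycles D.toTheta D.DeltaTheta C.GtpYdduu) (hf : f ∈ C.rootCocycles hC)
  (hmods : ∀ (M M' : ℕ+) (h : (M : ℕ) ∣ (M' : ℕ)) (x : D.lDeltaTheta l),
    MuN.red p M M' h ((mods M').red x) = (mods M).red x)
  (h15 : Literature.AnabelianGeometry.EtaleTheta.ThetaSetting.Prop15iii E hC) (L : C.CuspLabels)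
  (hZ : ∀ M : ℕ+, Nonempty (ModelCyclotomes.lDeltaQuot (C.rigidData (mods M) hC hS h15 L) ≃*
    Literature.IUT.HodgeTheaters.ZHat))
  (hcharY : EtaleThetaDataOfSetting.PiYddCharacteristic C)
  (hlim : Function.Bijective (rigidLimHom C hC hS hl hp2 hpl hζ mods f hf hmods h15 L hZ))
  [(EtaleThetaDataOfSetting.PiYdd C).Normal] [hYN : D.GtpYdd.Normal]
  (hO : D.IsEtThOrigin) {Es : Set ℕ+} (τc : D.CyclotomeTower l Es)
  -- the [EtTh] inversion datum
  (ι : D.PiTemp ≃ₜ* D.PiTemp) (hιX : C.Huu.map ι.toMulEquiv.toMonoidHom = C.Huu) (cι : ThetaSetting.ThetaCompanion ι)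
  (γ : Pi C) (hγ : C.toLZ γ = Multiplicative.ofAdd 1) (hZι : D.toZ (ι (γ : D.PiTemp)) = (D.toZ (γ : D.PiTemp))⁻¹)
  (δ : Pi C) (hιι : ∀ x : Pi C, ι (ι (x : D.PiTemp)) = (δ : D.PiTemp) * (x : D.PiTemp) * (δ : D.PiTemp)⁻¹)
  (hβ : ∀ a : D.GtpTheta, a ∈ D.DeltaTheta → cι.thetaIso a * a⁻¹ ∈ D.lDeltaTheta l)
  -- the FUNCTION-level [EtTh] Prop 1.4 package
  (T : D.ThetaKummerInput) (hη : E.etaDd = T.kummerTheta)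
  (hdeck : ∀ e' : D.PiTemp, e' ∈ D.GtpY → e' ∉ D.GtpYdd → e' • T.theta = T.const (-1) * T.theta)
  (ιFn : T.Fn →* T.Fn)
  (hιFn : ∀ (g : Pi C) (f : T.Fn), ιFn ((g : D.PiTemp) • f) = ι (g : D.PiTemp) • ιFn f)
  (hΛ : ∀ ζ : cyclotome T.Fn, ContH1Aut.coeffMap D.DeltaTheta cι.thetaIso (thetaCompanion_mem_deltaTheta ι cι)
      (T.coeff.hom ζ) = T.coeff.hom (cyclotome.map ιFn ζ))
  (hιθ : ιFn T.theta = T.const (-1) * T.theta)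
  {udd : T.Fn} (hu : udd ∈ MulAction.fixedPoints D.GtpYdd T.Fn) (xpow : ∀ m : ℤ, RootSystem (udd ^ m))
  (eexp : ℤ) (he : eexp ≠ 0)
  (hpow : ∀ k : ℤ, ∃ ck : (↥D.Kdd)ˣ, ((γ : D.PiTemp) ^ k) • T.theta = T.const ck * udd ^ (eexp * k) * T.theta)
  (hΛbij : Function.Bijective T.coeff.hom)
  (ord : T.Fn →* Multiplicative ℚ) (hordc : ∀ ck, ord (T.const ck) = 1) (hordu : ord udd ≠ 1)
  {d : ℕ} (hd : 0 < d)
  (hint : ∀ f ∈ MulAction.fixedPoints ((PiYdd C ⊓ ⊤).map C.Huu.subtype) T.Fn,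
    ∃ z : ℤ, Multiplicative.toAdd (ord f) = z / d)
  {A : Type} [CommGroup A] [MulDistribMulAction (Pi C) A] [TopologicalSpace A] [RootableBy A ℕ]
  (c : CyclotomeCoefficients (phi C) (D.lDeltaTheta l) A)
  (hA : ∀ b : A, IsOpen (MulAction.stabilizer (Pi C) b : Set (Pi C)))
  (hfi : ∀ b : A, (MulAction.stabilizer (Pi C) b).FiniteIndex)
  (O : Submonoid A)
  {Iota : Type}
  (iota : Iota → ((thetaEnvData C hC hS hl hp2 hpl hζ mods f hf hmods h15 L hZ hcharY hlim).D.coh.lim ≃+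
    (thetaEnvData C hC hS hl hp2 hpl hζ mods f hf hmods h15 L hZ hcharY hlim).D.coh.lim))

section InftyCapstone

variable (hOstab : ∀ (σ : Pi C) (b : A), b ∈ O → σ • b ∈ O)
  {Lbl : Type*} {P₀ : TopGroup.{0}} (φ₀ : P₀ →* D.GtpTheta) (s : Lbl → (P₀ →* Pi C))
  (hι : ∀ t, Continuous ((MonoidHom.id (Pi C)).comp (s t)))
  (hN : ∀ t, (⊤ : Subgroup P₀).map ((MonoidHom.id (Pi C)).comp (s t)) ≤ PiYdd C)
  (hφ : ∀ t, (phi C).comp ((MonoidHom.id (Pi C)).comp (s t)) = φ₀)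

include hS hO τc hγ hZι hιι hβ hη hdeck hιFn hΛ hιθ hu xpow he hpow hΛbij hordc hordu hd hint hOstab in
/-- **IUTchII:Cor3.5(ii)** (kurims p.95) at `∞Ψ^ι_env(𝕄_*)`, FAITHFUL (torsion) form, **AT THE GENUINE `θ_env` DATA — CLOSING DECL OF RECORD of
the `∞`-clause**: for any inversion family whose `i₀`-th member is the limit action of the [EtTh] inversion `ι`, every `θ ∈ θ^{i₀}_env(𝕄_*)`
and `x ∈ ∞Ψ^{i₀}_env = M^×_TM · ⟨∞θ^{i₀}_env⟩`, the product restriction of `s_{t₀}(g)·x` is the diagonal translate of that of `x` up to a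
family of `n`-torsion classes (`n > 0`) — abc-iut-w4-d004 gen 3's `pi_restriction_inftyThetaMonoid_upToTorsion_toRecord_of_mem_thetaEnv` with
print's root condition `hroots` supplied by `horb_and_hroots_toRecord_inversion_of_thetaKummer` (conjunct 2).
[cite: Mochizuki2012, Cor 3.5 (ii) p.95] -/
theorem pi_restriction_inftyThetaMonoid_upToTorsion_toRecord_of_thetaKummer (hc : Function.Bijective c.hom)
    (hOtors : ∀ a : A, IsOfFinOrder a → a ∈ O ∧ a⁻¹ ∈ O)
    {K : Type*} [Group K] (q : Pi C →* K) (hq : ∀ x : Pi C, q x = 1 → ∀ a ∈ O, x • a = a) (w : P₀ →* K)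
    (hsec : ∀ t g, q (s t g) = w g) {i₀ : Iota}
    (hi₀ : iota i₀ = pairRhoLim C (inversionAlpha C ι hιX) cι.thetaIso (thetaCompanion_phi C ι hιX cι)
      (mem_lDeltaTheta_iff_thetaCompanion ι cι l) (mem_PiYdd_iff_of_piYddCharacteristic C hcharY _))
    {θ : ((thetaEnvData C hC hS hl hp2 hpl hζ mods f hf hmods h15 L hZ hcharY hlim).toRecord
        (h1LimConjMulAut (phi C) (D.lDeltaTheta l) (PiYdd C)) (h1LimKummerOn (phi C) (D.lDeltaTheta l) (PiYdd C) c hA hfi O)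
        iota).H}
    (hθ : θ ∈ ((thetaEnvData C hC hS hl hp2 hpl hζ mods f hf hmods h15 L hZ hcharY hlim).toRecord
        (h1LimConjMulAut (phi C) (D.lDeltaTheta l) (PiYdd C)) (h1LimKummerOn (phi C) (D.lDeltaTheta l) (PiYdd C) c hA hfi O)
        iota).thetaEnv i₀)
    (R : Lbl → (((thetaEnvData C hC hS hl hp2 hpl hζ mods f hf hmods h15 L hZ hcharY hlim).toRecord
        (h1LimConjMulAut (phi C) (D.lDeltaTheta l) (PiYdd C)) (h1LimKummerOn (phi C) (D.lDeltaTheta l) (PiYdd C) c hA hfi O)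
        iota).H →*
      Multiplicative (h1Lim φ₀ (D.lDeltaTheta l) (⊤ : Subgroup P₀) ⊥)))
    (hR : ∀ t y, Multiplicative.toAdd (R t y) =
      h1LimCongr (D.lDeltaTheta l) ⊤ (hφ t) ⊥
        (h1LimComap (phi C) (D.lDeltaTheta l) ((MonoidHom.id (Pi C)).comp (s t)) (hι t) (hN t)
          (AddEquiv.additiveMultiplicative (h1Lim (phi C) (D.lDeltaTheta l) (PiYdd C) ⊥) (Additive.ofMul y))))
    {x : ((thetaEnvData C hC hS hl hp2 hpl hζ mods f hf hmods h15 L hZ hcharY hlim).toRecord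
        (h1LimConjMulAut (phi C) (D.lDeltaTheta l) (PiYdd C)) (h1LimKummerOn (phi C) (D.lDeltaTheta l) (PiYdd C) c hA hfi O)
        iota).H}
    (hx : x ∈ ((thetaEnvData C hC hS hl hp2 hpl hζ mods f hf hmods h15 L hZ hcharY hlim).toRecord
        (h1LimConjMulAut (phi C) (D.lDeltaTheta l) (PiYdd C)) (h1LimKummerOn (phi C) (D.lDeltaTheta l) (PiYdd C) c hA hfi O)
        iota).inftyThetaMonoid i₀)
    (t₀ : Lbl) (g : P₀) :
    ∃ (n : ℕ) (u : Lbl → ((thetaEnvData C hC hS hl hp2 hpl hζ mods f hf hmods h15 L hZ hcharY hlim).toRecord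
        (h1LimConjMulAut (phi C) (D.lDeltaTheta l) (PiYdd C)) (h1LimKummerOn (phi C) (D.lDeltaTheta l) (PiYdd C) c hA hfi O)
        iota).H),
      0 < n ∧ (∀ t, u t ^ n = 1) ∧
      MonoidHom.pi R
          (((thetaEnvData C hC hS hl hp2 hpl hζ mods f hf hmods h15 L hZ hcharY hlim).toRecord
        (h1LimConjMulAut (phi C) (D.lDeltaTheta l) (PiYdd C)) (h1LimKummerOn (phi C) (D.lDeltaTheta l) (PiYdd C) c hA hfi O)
        iota).conj (s t₀ g) x) =
        (fun t => R t (u t)) * piIso Lbl (h1LimConjMulAut φ₀ (D.lDeltaTheta l) ⊤ g) (MonoidHom.pi R x) :=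
  pi_restriction_inftyThetaMonoid_upToTorsion_ofKummerHom_labelwise
    ((thetaEnvData C hC hS hl hp2 hpl hζ mods f hf hmods h15 L hZ hcharY hlim).toRecord
        (h1LimConjMulAut (phi C) (D.lDeltaTheta l) (PiYdd C)) (h1LimKummerOn (phi C) (D.lDeltaTheta l) (PiYdd C) c hA hfi O)
        iota)
    (MulDistribMulAction.toMulAut (Pi C) A) O (fun σ b hb => hOstab σ b hb)
    (h1LimKummerOn (phi C) (D.lDeltaTheta l) (PiYdd C) c hA hfi O) (phi C) φ₀ (D.lDeltaTheta l) (PiYdd C)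
    (MonoidHom.id (Pi C)) (AddEquiv.additiveMultiplicative (h1Lim (phi C) (D.lDeltaTheta l) (PiYdd C) ⊥)) s hι hN hφ
    (ThetaEnvData.toRecord_constantMonoid _ _ _ _)
    (fun (σ : Pi C) m => h1LimKummerOn_smul (phi C) (D.lDeltaTheta l) (PiYdd C) c hA hfi O σ m
      ⟨σ • (m : A), hOstab σ m m.2⟩ rfl)
    q (fun x hx a ha => hq x hx a ha) w hsec
    (fun _ _ => rfl) i₀ θ
    (toRecord_topClass (thetaEnvData C hC hS hl hp2 hpl hζ mods f hf hmods h15 L hZ hcharY hlim)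
      (CohomologySystemOfContH1.h1LimConjMulAut (phi C) (D.lDeltaTheta l) (PiYdd C))
      (h1LimKummerOn (phi C) (D.lDeltaTheta l) (PiYdd C) c hA hfi O)
      iota
      (phi C) (D.lDeltaTheta l) (PiYdd C)
      (AddEquiv.additiveMultiplicative (h1Lim (phi C) (D.lDeltaTheta l) (PiYdd C) ⊥)) (fun y _ => ⟨y, rfl⟩) hθ)
    (horb_and_hroots_toRecord_inversion_of_thetaKummer C hC hS hl hp2 hpl hζ mods f hf hmods h15 L hZ hcharY hlim hO τc ι hιX cι
      γ hγ hZι δ hιι hβ T hη hdeck ιFn hιFn hΛ hιθ hu xpow eexp he hpow hΛbij ord hordc hordu hd hint iota c hA hfi O hc hOtors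
      hi₀ hθ).2
    R hR hx t₀ g


end InftyCapstone

end EtaleLevels

end Literature.IUT.HodgeArakelov

end
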